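import Literature.Probability.RandomPlanarGeometry.BrownianBubbles
import Literature.Probability.RandomPlanarGeometry.KernelConvergence
import HarnessLib

/-!
# Restriction maps have a real third-order jet at `0` — the named fact `IsStarHull.exists_hasRestrictionJet` PROVED

Proof-only companion of `Literature.Probability.RandomPlanarGeometry.BrownianBubbles`, after

* G. F. Lawler, O. Schramm, W. Werner, *Conformal restriction: the chordal case*, J. Amer. Math.
  Soc. **16** (2003) 917–955, arXiv:math/0209343 (**[LSW]**), p. 7: "the maps may be extended
  to a neighborhood of `0` by Schwarz reflection in the real line";
* G. F. Lawler, *Conformally Invariant Processes in the Plane* (2005), proof of Prop. 5.22: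
  "`f(z) = z + x z² + [x² − hcap(A)] z³ + ⋯`".

`Literature.Probability.RandomPlanarGeometry.IsStarHull.exists_hasRestrictionJet_holds`: for
`A ∈ 𝒬*` and a restriction map `Φ` of `A`, `Φ(z) = d z + c₂ z² + c₃ z³ + o(z³)` as `z → 0` in
`ℍ ∖ A` with REAL `d, c₂, c₃`. Proof: the reflected extension `G` of `Φ` (the tree's
`reflectExt`, `KernelConvergence`: holomorphic on a ball `B(0, r)`, `G = Φ` on the upper
half-ball, `G(0) = 0`, real on the real diameter) is analytic at `0`
(`DifferentiableOn.analyticAt`); Taylor's formula with remainder for its power series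
(`HasFPowerSeriesAt.isBigO_sub_partialSum_pow`) gives complex coefficients `a₁, a₂, a₃` with
`G(y) − a₁ y − a₂ y² − a₃ y³ = O(|y|⁴)`; the coefficients are real because they are successive
limits of real quantities along the positive real axis (`G(t)/t`, `(G(t) − a₁ t)/t²`,
`(G(t) − a₁ t − a₂ t²)/t³`, `t ↓ 0`).

Mathlib: `DifferentiableOn.analyticAt`, `HasFPowerSeriesAt.isBigO_sub_partialSum_pow`,
`FormalMultilinearSeries.apply_eq_pow_smul_coeff`, `HasFPowerSeriesAt.coeff_zero`,
`Complex.isometry_ofReal`.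
-/

noncomputable section

open Set Filter Topology Metric Asymptotics Complex
open UpperHalfPlane (upperHalfPlaneSet)
open scoped ComplexConjugate

namespace Literature.Probability.RandomPlanarGeometry

section Jet

variable {A : Set ℂ} {Φ : ConformalEquiv (upperHalfPlaneSet \ A) upperHalfPlaneSet} {r : ℝ}
variable (hA : IsStarHull A) (hΦ : IsRestrictionMap A Φ) (hr : Disjoint (ball (0 : ℂ) (2 * r)) A)
include hA hΦ hr

/-- The reflected extension is real on the real diameter `(-r, r)`. [folklore] -/
theorem reflectExt_ofReal_im {t : ℝ} (ht : |t| < r) : (reflectExt hA hΦ hr t).im = 0 := by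
  have hG := Classical.choose_spec (hΦ.exists_extension hA hr)
  simp only [reflectExt, ofReal_im, le_refl, if_true]
  exact hΦ.extension_ofReal_im hA hr hG.1 hG.2 ht

end Jet

/-- A complex number which is a limit of real numbers (along a nontrivial filter) is real. [folklore] -/
theorem im_eq_zero_of_tendsto_ofReal {ι : Type*} {l : Filter ι} [l.NeBot] {f : ι → ℂ} {a : ℂ}
    (hf : Tendsto f l (𝓝 a)) (hreal : ∀ᶠ i in l, (f i).im = 0) : a.im = 0 := by
  have h := (continuous_im.tendsto a).comp hf
  have h0 : Tendsto (fun i ↦ (f i).im) l (𝓝 0) :=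
    tendsto_const_nhds.congr' (hreal.mono fun i hi ↦ hi.symm)
  exact tendsto_nhds_unique h h0

/-- **Taylor expansion to third order of a function holomorphic on a ball about `0` with
`G(0) = 0`**: there are complex `a₁, a₂, a₃` with
`(G(y) − (a₁ y + a₂ y² + a₃ y³))/y³ → 0` as `y → 0`, `y ≠ 0`. [folklore] -/
theorem exists_jet_of_differentiableOn_ball {G : ℂ → ℂ} {r : ℝ} (hr0 : 0 < r)
    (hG : DifferentiableOn ℂ G (ball (0 : ℂ) r)) (hG0 : G 0 = 0) :
    ∃ a₁ a₂ a₃ : ℂ, Tendsto (fun y ↦ (G y - (a₁ * y + a₂ * y ^ 2 + a₃ * y ^ 3)) / y ^ 3)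
      (𝓝[≠] 0) (𝓝 0) := by
  have hGa : AnalyticAt ℂ G 0 := hG.analyticAt (ball_mem_nhds 0 hr0)
  obtain ⟨p, hp⟩ := hGa
  refine ⟨p.coeff 1, p.coeff 2, p.coeff 3, ?_⟩
  -- Taylor with remainder: `G y - partialSum 4 y = O(‖y‖^4)`
  have hO := hp.isBigO_sub_partialSum_pow 4
  have hps : ∀ y : ℂ, p.partialSum 4 y = p.coeff 1 * y + p.coeff 2 * y ^ 2 + p.coeff 3 * y ^ 3 := by
    intro y
    have h0 : p.coeff 0 = 0 := by
      rw [FormalMultilinearSeries.coeff, hp.coeff_zero, hG0]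
    simp only [FormalMultilinearSeries.partialSum, Finset.sum_range_succ, Finset.sum_range_zero,
      FormalMultilinearSeries.apply_eq_pow_smul_coeff, smul_eq_mul, h0, zero_add, pow_zero,
      mul_zero, pow_one]
    ring
  have hO' : (fun y ↦ G y - (p.coeff 1 * y + p.coeff 2 * y ^ 2 + p.coeff 3 * y ^ 3)) =O[𝓝 0]
      fun y ↦ ‖y‖ ^ 4 := by
    refine hO.congr' (Eventually.of_forall fun y ↦ ?_) EventuallyEq.rfl
    simp only [zero_add, hps]
  -- divide by `y ^ 3`
  obtain ⟨C, hC⟩ := hO'.bound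
  have hbound : ∀ᶠ y in 𝓝[≠] (0 : ℂ),
      ‖(G y - (p.coeff 1 * y + p.coeff 2 * y ^ 2 + p.coeff 3 * y ^ 3)) / y ^ 3‖ ≤ C * ‖y‖ := by
    filter_upwards [mem_nhdsWithin_of_mem_nhds hC, self_mem_nhdsWithin] with y hy hy0
    have hy0' : y ≠ 0 := hy0
    have hny : 0 < ‖y‖ := norm_pos_iff.2 hy0'
    rw [norm_div, norm_pow, div_le_iff₀ (by positivity)]
    calc ‖G y - (p.coeff 1 * y + p.coeff 2 * y ^ 2 + p.coeff 3 * y ^ 3)‖ ≤ C * ‖‖y‖ ^ 4‖ := hy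
      _ = C * ‖y‖ * ‖y‖ ^ 3 := by rw [Real.norm_eq_abs, abs_of_nonneg (by positivity)]; ring
  have hlim : Tendsto (fun y : ℂ ↦ C * ‖y‖) (𝓝[≠] 0) (𝓝 0) := by
    have : Tendsto (fun y : ℂ ↦ C * ‖y‖) (𝓝 0) (𝓝 (C * ‖(0 : ℂ)‖)) :=
      (continuous_const.mul continuous_norm).tendsto 0
    rw [norm_zero, mul_zero] at this
    exact this.mono_left nhdsWithin_le_nhds
  exact squeeze_zero_norm' hbound hlim

/-- **`IsStarHull.exists_hasRestrictionJet` holds**: every restriction map of a `*`-hull has a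
real third-order jet at `0` (Schwarz reflection, analyticity, and reality of the Taylor
coefficients of a function real on the real axis).
[cite: Lawler2005, proof of Prop. 5.22 (§5.5)] -/
theorem IsStarHull.exists_hasRestrictionJet_holds : IsStarHull.exists_hasRestrictionJet := by
  intro A hA Φ hΦ
  obtain ⟨r, hr0, hr⟩ := hA.exists_disjoint_ball
  set G := reflectExt hA hΦ hr with hGdef
  have hGd : DifferentiableOn ℂ G (ball (0 : ℂ) r) := differentiableOn_reflectExt hA hΦ hr
  have hG0 : G 0 = 0 := reflectExt_zero hA hΦ hr hr0
  obtain ⟨a₁, a₂, a₃, hJ⟩ := exists_jet_of_differentiableOn_ball hr0 hGd hG0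
  -- the remainder along the positive real axis
  set J : ℂ → ℂ := fun y ↦ (G y - (a₁ * y + a₂ * y ^ 2 + a₃ * y ^ 3)) / y ^ 3 with hJdef
  have hreal_filter : Tendsto (fun t : ℝ ↦ (t : ℂ)) (𝓝[>] 0) (𝓝[≠] 0) := by
    refine tendsto_nhdsWithin_of_tendsto_nhds_of_eventually_within _
      ((continuous_ofReal.tendsto' 0 0 (by simp)).mono_left nhdsWithin_le_nhds) ?_
    filter_upwards [self_mem_nhdsWithin] with t ht
    exact ofReal_ne_zero.2 (ne_of_gt ht)
  have hJt : Tendsto (fun t : ℝ ↦ J t) (𝓝[>] 0) (𝓝 0) := hJ.comp hreal_filter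
  -- `G` is real at small positive reals
  have hGreal : ∀ᶠ t : ℝ in 𝓝[>] 0, (G t).im = 0 := by
    have : ∀ᶠ t : ℝ in 𝓝 0, |t| < r := by
      have := (continuous_abs.tendsto (0 : ℝ))
      rw [abs_zero] at this
      exact this (Iio_mem_nhds hr0)
    filter_upwards [mem_nhdsWithin_of_mem_nhds this] with t ht
    exact reflectExt_ofReal_im hA hΦ hr ht
  have ht0 : ∀ᶠ t : ℝ in 𝓝[>] 0, (t : ℂ) ≠ 0 := by
    filter_upwards [self_mem_nhdsWithin] with t ht
    exact ofReal_ne_zero.2 (ne_of_gt ht)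
  have htends : Tendsto (fun t : ℝ ↦ (t : ℂ)) (𝓝[>] 0) (𝓝 0) := by
    have := (continuous_ofReal.tendsto' 0 0 (by simp)).mono_left (nhdsWithin_le_nhds (s := Ioi (0 : ℝ)))
    exact this
  -- a₁ is real: `G t / t = a₁ + a₂ t + a₃ t² + J t · t²… → a₁`
  have ha₁ : a₁.im = 0 := by
    have hlim : Tendsto (fun t : ℝ ↦ G t / t) (𝓝[>] 0) (𝓝 a₁) := by
      have h := ((tendsto_const_nhds (x := a₁)).add ((tendsto_const_nhds (x := a₂)).mul htends)).add
        (((tendsto_const_nhds (x := a₃)).mul (htends.pow 2)).add (hJt.mul (htends.pow 2)))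
      simp only [mul_zero, add_zero, zero_pow two_ne_zero] at h
      refine h.congr' ?_
      filter_upwards [ht0] with t ht
      simp only [hJdef]
      field_simp
      ring
    refine im_eq_zero_of_tendsto_ofReal hlim ?_
    filter_upwards [hGreal] with t ht
    rw [div_ofReal_im, ht, zero_div]
  -- a₂ is real: `(G t - a₁ t)/t² → a₂`
  have ha₂ : a₂.im = 0 := by
    have hlim : Tendsto (fun t : ℝ ↦ (G t - a₁ * t) / (t : ℂ) ^ 2) (𝓝[>] 0) (𝓝 a₂) := by
      have h := ((tendsto_const_nhds (x := a₂)).add ((tendsto_const_nhds (x := a₃)).mul htends)).add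
        (hJt.mul htends)
      simp only [mul_zero, add_zero] at h
      refine h.congr' ?_
      filter_upwards [ht0] with t ht
      simp only [hJdef]
      field_simp
      ring
    refine im_eq_zero_of_tendsto_ofReal hlim ?_
    filter_upwards [hGreal] with t ht
    have : (G t - a₁ * t) / (t : ℂ) ^ 2 = (((G t).re - a₁.re * t) / t ^ 2 : ℝ) := by
      have hG' : G t = ((G t).re : ℂ) := by
        apply Complex.ext <;> simp [ht]
      have ha' : a₁ = (a₁.re : ℂ) := by
        apply Complex.ext <;> simp [ha₁]
      rw [hG', ha']
      simp only [ofReal_re]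
      push_cast
      ring
    rw [this, ofReal_im]
  -- a₃ is real: `(G t - a₁ t - a₂ t²)/t³ → a₃`
  have ha₃ : a₃.im = 0 := by
    have hlim : Tendsto (fun t : ℝ ↦ (G t - a₁ * t - a₂ * (t : ℂ) ^ 2) / (t : ℂ) ^ 3) (𝓝[>] 0) (𝓝 a₃) := by
      have h := (tendsto_const_nhds (x := a₃)).add hJt
      simp only [add_zero] at h
      refine h.congr' ?_
      filter_upwards [ht0] with t ht
      simp only [hJdef]
      field_simp
      ring
    refine im_eq_zero_of_tendsto_ofReal hlim ?_
    filter_upwards [hGreal] with t ht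
    have : (G t - a₁ * t - a₂ * (t : ℂ) ^ 2) / (t : ℂ) ^ 3 =
        (((G t).re - a₁.re * t - a₂.re * t ^ 2) / t ^ 3 : ℝ) := by
      have hG' : G t = ((G t).re : ℂ) := by
        apply Complex.ext <;> simp [ht]
      have ha' : a₁ = (a₁.re : ℂ) := by
        apply Complex.ext <;> simp [ha₁]
      have ha'' : a₂ = (a₂.re : ℂ) := by
        apply Complex.ext <;> simp [ha₂]
      rw [hG', ha', ha'']
      simp only [ofReal_re]
      push_cast
      ring
    rw [this, ofReal_im]
  -- assemble the jet inside `ℍ ∖ A`, where `G = Φ` near `0`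
  refine ⟨a₁.re, a₂.re, a₃.re, ?_⟩
  have ha₁' : ((a₁.re : ℝ) : ℂ) = a₁ := Complex.ext (by simp) (by simp [ha₁])
  have ha₂' : ((a₂.re : ℝ) : ℂ) = a₂ := Complex.ext (by simp) (by simp [ha₂])
  have ha₃' : ((a₃.re : ℝ) : ℂ) = a₃ := Complex.ext (by simp) (by simp [ha₃])
  unfold HasRestrictionJet
  rw [ha₁', ha₂', ha₃']
  have hsub : upperHalfPlaneSet \ A ⊆ ({0}ᶜ : Set ℂ) := fun z hz h0 ↦ by
    have : (0 : ℝ) < z.im := hz.1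
    rw [show z = 0 from h0, zero_im] at this
    exact lt_irrefl _ this
  refine (hJ.mono_left (nhdsWithin_mono _ hsub)).congr' ?_
  -- eventually in `𝓝[ℍ ∖ A] 0` the point lies in the upper half-ball, where `G = Φ`
  have hball : ∀ᶠ z in 𝓝[upperHalfPlaneSet \ A] (0 : ℂ), z ∈ ball (0 : ℂ) r :=
    mem_nhdsWithin_of_mem_nhds (ball_mem_nhds 0 hr0)
  filter_upwards [hball, self_mem_nhdsWithin] with z hz hzU
  simp only [hJdef]
  rw [show G z = Φ z from reflectExt_eq hA hΦ hr ⟨hzU.1, hz⟩]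

end Literature.Probability.RandomPlanarGeometry

end
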